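import Summits.Ventures.YMGap.RobustBall.BallClosure
import Summits.Ventures.YMGap.RobustBall.MassGapOnBallZdG
import Summits.Ventures.YMGap.RobustBall.LocalSourceScreening
import HarnessLib

/-!
# Venture YMGap, track ROBUST-BALL (Y2) — closure properties of ds-2's gauge-invariant tier-1 ball `MemBallZdG ε₀ ε₁ R`: sums, scalings,
# truncations (the tier-1 twin of `BallClosure.lean`)

HONEST FRAMING. WHAT THIS IS: a venture file (cell `pub-ymgap`, track Y2 ROBUST-BALL, seat rb-p1, theorems only): STRUCTURE of the finite-range
gauge-invariant ball of `MassGapOnBallZdG.lean`.  The loads are (sub)additive and homogeneous, so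
* `MemBallZdG.add` — `(W₁, supp₁) ∈ Ball(ε₀, ε₁, R)`, `(W₂, supp₂) ∈ Ball(ε₀', ε₁', R')` ⇒ `(W₁ + W₂, supp₁ ∪ supp₂) ∈ Ball(ε₀ + ε₀', ε₁ + ε₁', max R R')`
  (witnesses switched off on the inactive terms, so each load sum runs over the member's own listed sets);
* `MemBallZdG.smul` — `(c • W, supp) ∈ Ball(|c| ε₀, |c| ε₁, R)`; `MemBallZdG.mono` — larger loads / range;
* `MemBallZdG.indicator` — every truncation `𝟙_T W` (a set `T` of terms switched on) stays in the ball with the same support family and loads;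
* `MemBallZdG.add_smul_indicator` — the truncated lines `W + s·𝟙_T V` of a direction `V ∈ Ball(ε₀V, ε₁V, R_V)` stay in
  `Ball(ε₀ + s₀ε₀V, ε₁ + s₀ε₁V, max R R_V)` for `|s| ≤ s₀` — the bookkeeping the star-door derivative chain needs (cf. the tier-2
  `TruncationConvergenceS.memBallZdS_add_smul_indicator`).
WHAT THIS IS NOT: any statement about states; pure bookkeeping of the ball; nothing about the continuum limit or a Clay-sense mass gap.
-/

noncomputable section

open MeasureTheory Function Finset Real
open Literature.Probability.LatticeModels
open Literature.Probability.LatticeModels.DobrushinMetric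
open Literature.MathematicalPhysics.QuantumLattice
open Literature.MathematicalPhysics.QuantumFieldTheory hiding ZdEdge

namespace Summit.Ventures.YMGap.RobustBall

variable {d N : ℕ}

/-! ### Switched-off witnesses -/

section Witness

variable {W : Potential (ZdEdge d) (SUN N)}

/-- Switching a witness off on an inactive (zero) term keeps it an oscillation witness. -/
theorem isOscBound_ite_zero [DecidablePred fun X : Finset (ZdEdge d) => W X = 0] {osc : Finset (ZdEdge d) → ZdEdge d → ℝ}
    (h : ∀ X, Dobrushin.IsOscBound (W X) (osc X)) (X : Finset (ZdEdge d)) :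
    Dobrushin.IsOscBound (W X) (fun y => if W X = 0 then 0 else osc X y) := by
  by_cases h0 : W X = 0
  · refine ⟨fun y => by rw [if_pos h0], fun y σ τ _ => ?_⟩
    rw [if_pos h0, h0]; simp
  · simpa only [if_neg h0] using h X

/-- Switching a witness off on an inactive term keeps it a Lipschitz witness. -/
theorem isLipBound_ite_zero [DecidablePred fun X : Finset (ZdEdge d) => W X = 0] {lip : Finset (ZdEdge d) → ZdEdge d → ℝ}
    (h : ∀ X, IsLipBound suFrobDist (W X) (lip X)) (X : Finset (ZdEdge d)) :
    IsLipBound suFrobDist (W X) (fun y => if W X = 0 then 0 else lip X y) := by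
  by_cases h0 : W X = 0
  · refine ⟨fun y => by rw [if_pos h0], fun y σ τ _ => ?_⟩
    rw [if_pos h0, h0]; simp
  · simpa only [if_neg h0] using h X

/-- A switched-off witness sum over a finite family `A` is at most the full witness sum over any `B` containing the active members of `A`. -/
theorem sum_ite_zero_le_sum [DecidablePred fun X : Finset (ZdEdge d) => W X = 0] {g : Finset (ZdEdge d) → ℝ} (hg : ∀ X, 0 ≤ g X)
    {A B : Finset (Finset (ZdEdge d))} (hAB : ∀ X ∈ A, W X ≠ 0 → X ∈ B) :
    ∑ X ∈ A, (if W X = 0 then 0 else g X) ≤ ∑ X ∈ B, g X := by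
  classical
  have h1 : ∑ X ∈ A, (if W X = 0 then 0 else g X) = ∑ X ∈ A.filter (fun X => ¬ W X = 0), g X := by
    rw [Finset.sum_filter]
    exact Finset.sum_congr rfl fun X _ => by by_cases h : W X = 0 <;> simp [h]
  rw [h1]
  exact Finset.sum_le_sum_of_subset_of_nonneg (fun X hX => hAB X (Finset.mem_filter.1 hX).1 (Finset.mem_filter.1 hX).2) fun X _ _ => hg X

end Witness

/-! ### `listedAt` of a union of support families -/

/-- `listedAt` distributes over pointwise unions of support families. -/
theorem listedAt_union (supp₁ supp₂ : Finset (ZdEdge d) → Finset (Finset (ZdEdge d))) (v : Site d) :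
    listedAt (fun Λ => supp₁ Λ ∪ supp₂ Λ) v = listedAt supp₁ v ∪ listedAt supp₂ v := by
  classical
  ext X
  simp only [mem_listedAt, Finset.mem_union]
  constructor
  · rintro ⟨μ, h | h, hm⟩
    · exact Or.inl ⟨μ, h, hm⟩
    · exact Or.inr ⟨μ, h, hm⟩
  · rintro (⟨μ, h, hm⟩ | ⟨μ, h, hm⟩)
    · exact ⟨μ, Or.inl h, hm⟩
    · exact ⟨μ, Or.inr h, hm⟩

/-! ### Closure of the gauge-invariant ball -/

section Closure

variable {ε₀ ε₁ ε₀' ε₁' : ℝ} {R R' : ℕ} {W W₁ W₂ : Potential (ZdEdge d) (SUN N)}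
  {supp supp₁ supp₂ : Finset (ZdEdge d) → Finset (Finset (ZdEdge d))}

/-- **The gauge-invariant ball is monotone in its loads and range.** -/
theorem MemBallZdG.mono (h : MemBallZdG ε₀ ε₁ R W supp) (h₀ : ε₀ ≤ ε₀') (h₁ : ε₁ ≤ ε₁') (hR : R ≤ R') :
    MemBallZdG ε₀' ε₁' R' W supp := by
  obtain ⟨osc, lip, hosc, hlip, ho, hl⟩ := h.loads
  refine ⟨h.continuous, h.dependsOn, h.supportedBy, fun e X hX heX y hy => (h.range e X hX heX y hy).trans (by exact_mod_cast hR),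
    h.gaugeInvariant, osc, lip, hosc, hlip, fun e => (ho e).trans h₀, fun v => (hl v).trans h₁⟩

/-- **The gauge-invariant ball is closed under scaling**: `(c • W, supp) ∈ Ball(|c| ε₀, |c| ε₁, R)`. -/
theorem MemBallZdG.smul (h : MemBallZdG ε₀ ε₁ R W supp) (c : ℝ) : MemBallZdG (|c| * ε₀) (|c| * ε₁) R (c • W) supp := by
  classical
  obtain ⟨osc, lip, hosc, hlip, ho, hl⟩ := h.loads
  refine ⟨fun X => (h.continuous X).const_smul c, fun X σ τ hστ => by simp only [Pi.smul_apply, smul_eq_mul, h.dependsOn X hστ],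
    fun Λ A hA hne => h.supportedBy Λ A hA fun h0 => hne (by rw [Pi.smul_apply, h0, smul_zero]), h.range,
    fun X g U => by simp only [Pi.smul_apply, smul_eq_mul, h.gaugeInvariant X g U],
    fun X y => |c| * osc X y, fun X y => |c| * lip X y, fun X => isOscBound_smul (hosc X) c, fun X => isLipBound_smul (hlip X) c,
    fun e => ?_, fun v => ?_⟩
  · rw [← Finset.mul_sum]; exact mul_le_mul_of_nonneg_left (ho e) (abs_nonneg c)
  · simp_rw [← Finset.mul_sum]; exact mul_le_mul_of_nonneg_left (hl v) (abs_nonneg c)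

/-- **THE GAUGE-INVARIANT BALL IS CLOSED UNDER SUMS, loads adding**: `(W₁, supp₁) ∈ Ball(ε₀, ε₁, R)`, `(W₂, supp₂) ∈ Ball(ε₀', ε₁', R')` give
`(W₁ + W₂, supp₁ ∪ supp₂) ∈ Ball(ε₀ + ε₀', ε₁ + ε₁', max R R')`. -/
theorem MemBallZdG.add (h₁ : MemBallZdG ε₀ ε₁ R W₁ supp₁) (h₂ : MemBallZdG ε₀' ε₁' R' W₂ supp₂) :
    MemBallZdG (ε₀ + ε₀') (ε₁ + ε₁') (max R R') (W₁ + W₂) (fun Λ => supp₁ Λ ∪ supp₂ Λ) := by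
  classical
  obtain ⟨osc₁, lip₁, hosc₁, hlip₁, ho₁, hl₁⟩ := h₁.loads
  obtain ⟨osc₂, lip₂, hosc₂, hlip₂, ho₂, hl₂⟩ := h₂.loads
  refine ⟨fun X => (h₁.continuous X).add (h₂.continuous X),
    fun X σ τ hστ => by simp only [Pi.add_apply, h₁.dependsOn X hστ, h₂.dependsOn X hστ],
    isSupportedBy_add_union h₁.supportedBy h₂.supportedBy, fun e X hX heX y hy => ?_,
    fun X g U => by simp only [Pi.add_apply, h₁.gaugeInvariant X g U, h₂.gaugeInvariant X g U],
    fun X y => (if W₁ X = 0 then 0 else osc₁ X y) + (if W₂ X = 0 then 0 else osc₂ X y),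
    fun X y => (if W₁ X = 0 then 0 else lip₁ X y) + (if W₂ X = 0 then 0 else lip₂ X y),
    fun X => isOscBound_add (isOscBound_ite_zero hosc₁ X) (isOscBound_ite_zero hosc₂ X),
    fun X => isLipBound_add (isLipBound_ite_zero hlip₁ X) (isLipBound_ite_zero hlip₂ X), fun e => ?_, fun v => ?_⟩
  · -- range
    rcases Finset.mem_union.1 hX with hX | hX
    · exact (h₁.range e X hX heX y hy).trans (by exact_mod_cast le_max_left R R')
    · exact (h₂.range e X hX heX y hy).trans (by exact_mod_cast le_max_right R R')
  · -- oscillation load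
    rw [Finset.sum_add_distrib]
    have hA : ∀ {W' : Potential (ZdEdge d) (SUN N)} {supp' : Finset (ZdEdge d) → Finset (Finset (ZdEdge d))}, W'.IsSupportedBy supp' →
        ∀ X ∈ (supp₁ {e} ∪ supp₂ {e}).filter (fun X => e ∈ X), W' X ≠ 0 → X ∈ (supp' {e}).filter (fun X => e ∈ X) :=
      fun hs X hX hne => Finset.mem_filter.2
        ⟨hs {e} X ⟨e, Finset.mem_inter.2 ⟨(Finset.mem_filter.1 hX).2, Finset.mem_singleton_self e⟩⟩ hne, (Finset.mem_filter.1 hX).2⟩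
    exact add_le_add ((sum_ite_zero_le_sum (fun X => (hosc₁ X).nonneg e) (hA h₁.supportedBy)).trans (ho₁ e))
      ((sum_ite_zero_le_sum (fun X => (hosc₂ X).nonneg e) (hA h₂.supportedBy)).trans (ho₂ e))
  · -- Lipschitz load
    have hsplit : ∀ X : Finset (ZdEdge d), ∑ y ∈ X, ((if W₁ X = 0 then 0 else lip₁ X y) + (if W₂ X = 0 then 0 else lip₂ X y)) =
        (if W₁ X = 0 then 0 else ∑ y ∈ X, lip₁ X y) + (if W₂ X = 0 then 0 else ∑ y ∈ X, lip₂ X y) := fun X => by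
      rw [Finset.sum_add_distrib]; congr 1 <;> split_ifs <;> simp
    simp_rw [hsplit]
    rw [Finset.sum_add_distrib]
    have hA : ∀ {W' : Potential (ZdEdge d) (SUN N)} {supp' : Finset (ZdEdge d) → Finset (Finset (ZdEdge d))}, W'.IsSupportedBy supp' →
        ∀ X ∈ listedAt (fun Λ => supp₁ Λ ∪ supp₂ Λ) v, W' X ≠ 0 → X ∈ listedAt supp' v := by
      intro W' supp' hs X hX hne
      rw [listedAt_union, Finset.mem_union] at hX
      have key : ∀ {su : Finset (ZdEdge d) → Finset (Finset (ZdEdge d))}, X ∈ listedAt su v → X ∈ listedAt supp' v := by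
        intro su h
        obtain ⟨μ, -, hm⟩ := mem_listedAt.1 h
        exact mem_listedAt.2 ⟨μ, hs {((v, μ) : ZdEdge d)} X ⟨((v, μ) : ZdEdge d), Finset.mem_inter.2 ⟨hm, Finset.mem_singleton_self _⟩⟩ hne, hm⟩
      rcases hX with hX | hX
      · exact key hX
      · exact key hX
    exact add_le_add
      ((sum_ite_zero_le_sum (fun X => Finset.sum_nonneg fun y _ => (hlip₁ X).nonneg y) (hA h₁.supportedBy)).trans (hl₁ v))
      ((sum_ite_zero_le_sum (fun X => Finset.sum_nonneg fun y _ => (hlip₂ X).nonneg y) (hA h₂.supportedBy)).trans (hl₂ v))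

/-- **Truncations stay in the gauge-invariant ball**: for any set `T` of terms, `(𝟙_T W, supp) ∈ Ball(ε₀, ε₁, R)` with the same support family. -/
theorem MemBallZdG.indicator (h : MemBallZdG ε₀ ε₁ R W supp) (T : Set (Finset (ZdEdge d))) :
    MemBallZdG ε₀ ε₁ R (T.indicator W) supp := by
  classical
  obtain ⟨osc, lip, hosc, hlip, ho, hl⟩ := h.loads
  have hval : ∀ X, T.indicator W X = W X ∨ T.indicator W X = 0 := fun X => by
    by_cases hX : X ∈ T
    · exact Or.inl (Set.indicator_of_mem hX W)
    · exact Or.inr (Set.indicator_of_notMem hX W)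
  refine ⟨fun X => ?_, fun X σ τ hστ => ?_, fun Λ A hA hne => h.supportedBy Λ A hA fun h0 => hne ?_, h.range, fun X g U => ?_,
    osc, lip, fun X => ?_, fun X => ?_, ho, hl⟩
  · rcases hval X with hX | hX <;> rw [hX]
    · exact h.continuous X
    · exact continuous_const
  · rcases hval X with hX | hX <;> rw [hX]
    · exact h.dependsOn X hστ
    · rfl
  · rcases hval A with hX | hX
    · rw [hX, h0]
    · exact hX
  · rcases hval X with hX | hX <;> rw [hX]
    · exact h.gaugeInvariant X g U
    · rfl
  · rcases hval X with hX | hX <;> rw [hX]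
    · exact hosc X
    · exact ⟨(hosc X).nonneg, fun y σ τ _ => by simp only [Pi.zero_apply, sub_self, abs_zero]; exact (hosc X).nonneg y⟩
  · rcases hval X with hX | hX <;> rw [hX]
    · exact hlip X
    · exact ⟨(hlip X).nonneg, fun y σ τ _ => by
        simp only [Pi.zero_apply, sub_self, abs_zero]; exact mul_nonneg ((hlip X).nonneg y) (suFrobDist_nonneg _ _)⟩

/-- **Truncated lines stay in the ball**: `(W, supp) ∈ Ball(ε₀, ε₁, R)`, `(V, suppV) ∈ Ball(ε₀V, ε₁V, R_V)`, `|s| ≤ s₀`, `ε₀ + s₀ ε₀V ≤ a₀`,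
`ε₁ + s₀ ε₁V ≤ a₁` give `(W + s·𝟙_T V, supp ∪ suppV) ∈ Ball(a₀, a₁, max R R_V)` for every set of terms `T`. -/
theorem MemBallZdG.add_smul_indicator {ε₀V ε₁V s₀ a₀ a₁ : ℝ} {RV : ℕ} {V : Potential (ZdEdge d) (SUN N)}
    {suppV : Finset (ZdEdge d) → Finset (Finset (ZdEdge d))} (hW : MemBallZdG ε₀ ε₁ R W supp) (hV : MemBallZdG ε₀V ε₁V RV V suppV)
    (h₀V : 0 ≤ ε₀V) (h₁V : 0 ≤ ε₁V) (ha₀ : ε₀ + s₀ * ε₀V ≤ a₀) (ha₁ : ε₁ + s₀ * ε₁V ≤ a₁) {s : ℝ} (hs : |s| ≤ s₀)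
    (T : Set (Finset (ZdEdge d))) :
    MemBallZdG a₀ a₁ (max R RV) (W + s • T.indicator V) (fun Λ => supp Λ ∪ suppV Λ) :=
  (hW.add ((hV.indicator T).smul s)).mono ((add_le_add le_rfl (mul_le_mul_of_nonneg_right hs h₀V)).trans ha₀)
    ((add_le_add le_rfl (mul_le_mul_of_nonneg_right hs h₁V)).trans ha₁) le_rfl

end Closure

end Summit.Ventures.YMGap.RobustBall

end
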